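import Summits.QuantumAdvantage.AdviceFreeQNC0.BlockAdditiveMoves
import HarnessLib

/-!
# Cell qa-qnc0 (rung F-Q1, route RingFrame, crux α, line `product`): block-additive maps — residue
# counts for block weights and the context involution (qn-p1 TARGET §20.8, ask P6e; sequel of
# `BlockAdditiveMoves.lean`)

Second file of the prover's τ''-free proof of `Sketch8b.BlockAdditiveFSB`
(HOME/qa-qnc0-prover/PROVER-MEMO-gen4.md §2), all PROVED:

* residue counts for block weights by the character sum `Σ_u ω^{wt_S(u)} = 2^{L−|S|}(1+ω)^{|S|}`
  (`three_mul_card_filter_mod_eq_gen`, `norm_sum_omega3_pow_wtOn`, `card_filter_wtOn_mod_ge/le`: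
  the classes of a block weight on `|S| ≥ 2` coordinates have between `2^L/6` and `2^L/2` elements);
* `wt_start2`, `two_pow_le_six_mul_card_contexts`: the class-`r`-compatible contexts of a pair of
  moves on distinct blocks are at least `2^L/6` of all contexts (needs `k ≥ 3` blocks of size `≥ 2`);
* the CONTEXT INVOLUTION `ctxInv` on `Ω³` and `sum_indicator_start2`: every configuration is the
  start of exactly `4^L` (pattern, pattern, context) triples — the fibre-free double count behind
  "bad pairs are rare" (`BlockAdditivePairs.lean`).

WHAT THIS IS NOT: nothing on FSB/FW at general column degree, nothing on α; no separation claim.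
-/

noncomputable section

namespace Summit.QuantumAdvantage.AdviceFreeQNC0

open Finset
open Literature.Computability.MetaComplexity Literature.Computability.MetaComplexity.Smolensky

namespace BlockAdditive

variable {L L' k : ℕ}

/-! ### Residue counts for block weights -/

/-- The class-count identity for an arbitrary weight function `w`:
`3·#{u ∈ B : w u ≡ s (3)} = #B + 2·Re(ω^{2s}·Σ_{u∈B} ω^{w u})`. -/
theorem three_mul_card_filter_mod_eq_gen {α : Type*} (B : Finset α) (w : α → ℕ) (s : ℕ) :
    (3 : ℝ) * (B.filter fun u => w u % 3 = s % 3).card =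
      B.card + 2 * (omega3 ^ (2 * s) * ∑ u ∈ B, omega3 ^ w u).re := by
  rw [Finset.mul_sum, Complex.re_sum, Finset.card_filter, Nat.cast_sum, Finset.mul_sum,
    Finset.card_eq_sum_ones B, Nat.cast_sum, Finset.mul_sum, ← Finset.sum_add_distrib]
  refine Finset.sum_congr rfl fun u _ => ?_
  rw [← pow_add, add_comm (2 * s), Nat.cast_one, one_add_two_mul_omega3_pow_re]
  have hiff : w u % 3 = s % 3 ↔ (w u + 2 * s) % 3 = 0 := by omega
  by_cases h : w u % 3 = s % 3
  · rw [if_pos h, if_pos (hiff.1 h)]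
    norm_num
  · rw [if_neg h, if_neg fun h' => h (hiff.2 h')]
    norm_num

/-- Hence `|3·#{u ∈ B : w u ≡ s} − #B| ≤ 2·‖Σ_{u∈B} ω^{w u}‖`. -/
theorem abs_three_mul_card_filter_mod_sub_le_gen {α : Type*} (B : Finset α) (w : α → ℕ) (s : ℕ) :
    |(3 : ℝ) * (B.filter fun u => w u % 3 = s % 3).card - B.card| ≤ 2 * ‖∑ u ∈ B, omega3 ^ w u‖ := by
  rw [three_mul_card_filter_mod_eq_gen, add_sub_cancel_left, abs_mul, abs_two]
  refine mul_le_mul_of_nonneg_left ?_ (by norm_num)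
  calc |(omega3 ^ (2 * s) * ∑ u ∈ B, omega3 ^ w u).re|
      ≤ ‖omega3 ^ (2 * s) * ∑ u ∈ B, omega3 ^ w u‖ := Complex.abs_re_le_norm _
    _ = ‖∑ u ∈ B, omega3 ^ w u‖ := by rw [norm_mul, norm_pow, norm_omega3, one_pow, one_mul]

/-- `ω^{wt_S(u)} = Π_j (ω if j ∈ S ∧ u j else 1)`. -/
theorem omega3_pow_wtOn (S : Finset (Fin L)) (u : Fin L → Bool) :
    omega3 ^ wtOn S u = ∏ j, (if j ∈ S ∧ u j = true then omega3 else 1) := by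
  unfold wtOn
  rw [← Finset.prod_filter, Finset.prod_const]
  have hS : S.filter (fun j => u j = true) = univ.filter (fun j => j ∈ S ∧ u j = true) := by
    ext j
    simp only [Finset.mem_filter, Finset.mem_univ, true_and]
  rw [hS]

/-- `‖Σ_{u ∈ {0,1}^L} ω^{wt_S(u)}‖ = 2^{L − |S|}`. -/
theorem norm_sum_omega3_pow_wtOn (S : Finset (Fin L)) :
    ‖∑ u : Fin L → Bool, omega3 ^ wtOn S u‖ = (2 : ℝ) ^ (L - S.card) := by
  simp_rw [omega3_pow_wtOn]
  rw [← Fintype.prod_sum fun (j : Fin L) (b : Bool) => if j ∈ S ∧ b = true then omega3 else 1]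
  have hj : ∀ j : Fin L, (∑ b : Bool, if j ∈ S ∧ b = true then omega3 else (1 : ℂ)) =
      if j ∈ S then 1 + omega3 else 2 := by
    intro j
    rw [Fintype.sum_bool]
    by_cases h : j ∈ S
    · simp [h]; ring
    · simp [h]; norm_num
  simp_rw [hj]
  rw [norm_prod, ← Finset.prod_filter_mul_prod_filter_not univ (fun j => j ∈ S)]
  have h1 : ∏ j ∈ univ.filter (fun j : Fin L => j ∈ S), ‖if j ∈ S then 1 + omega3 else (2 : ℂ)‖ = 1 := by
    refine Finset.prod_eq_one fun j hj => ?_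
    rw [if_pos (Finset.mem_filter.1 hj).2, norm_one_add_omega3]
  have h2 : ∏ j ∈ univ.filter (fun j : Fin L => ¬ j ∈ S), ‖if j ∈ S then 1 + omega3 else (2 : ℂ)‖ =
      (2 : ℝ) ^ (L - S.card) := by
    rw [Finset.prod_congr rfl fun j hj => by rw [if_neg (Finset.mem_filter.1 hj).2]]
    rw [Finset.prod_const]
    have hc : (univ.filter fun j : Fin L => ¬ j ∈ S).card = L - S.card := by
      have := Finset.card_filter_add_card_filter_not (s := (univ : Finset (Fin L))) (p := fun j => j ∈ S)
      rw [Finset.filter_mem_eq_inter, Finset.univ_inter, Finset.card_univ, Fintype.card_fin] at this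
      omega
    rw [hc]
    norm_num
  rw [h1, h2, one_mul]

/-- **Residue classes of a block weight are large**: if `|S| ≥ 2` then
`6·#{u : wt_S(u) ≡ s} ≥ 2^L`. -/
theorem card_filter_wtOn_mod_ge (S : Finset (Fin L)) (hS : 2 ≤ S.card) (s : ℕ) :
    (2 : ℝ) ^ L ≤ 6 * ((univ.filter fun u : Fin L → Bool => wtOn S u % 3 = s % 3).card : ℝ) := by
  have h := abs_three_mul_card_filter_mod_sub_le_gen (univ : Finset (Fin L → Bool)) (wtOn S) s
  rw [norm_sum_omega3_pow_wtOn, Finset.card_univ, Fintype.card_fun, Fintype.card_bool,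
    Fintype.card_fin] at h
  have hpow : (2 : ℝ) ^ (L - S.card) * 4 ≤ (2 : ℝ) ^ L := by
    have : (2 : ℝ) ^ (L - S.card) * 2 ^ 2 ≤ (2 : ℝ) ^ L := by
      rw [← pow_add]
      exact pow_le_pow_right₀ (by norm_num) (by
        have : S.card ≤ L := by simpa using Finset.card_le_univ S
        omega)
    norm_num at this
    exact this
  have h' := (abs_le.1 h).1
  push_cast at h'
  linarith

/-- **… and not too large**: if `|S| ≥ 2` then `2·#{u : wt_S(u) ≡ s} ≤ 2^L`. -/
theorem card_filter_wtOn_mod_le (S : Finset (Fin L)) (hS : 2 ≤ S.card) (s : ℕ) :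
    2 * ((univ.filter fun u : Fin L → Bool => wtOn S u % 3 = s % 3).card : ℝ) ≤ (2 : ℝ) ^ L := by
  have h := abs_three_mul_card_filter_mod_sub_le_gen (univ : Finset (Fin L → Bool)) (wtOn S) s
  rw [norm_sum_omega3_pow_wtOn, Finset.card_univ, Fintype.card_fun, Fintype.card_bool,
    Fintype.card_fin] at h
  have hpow : (2 : ℝ) ^ (L - S.card) * 4 ≤ (2 : ℝ) ^ L := by
    have : (2 : ℝ) ^ (L - S.card) * 2 ^ 2 ≤ (2 : ℝ) ^ L := by
      rw [← pow_add]
      exact pow_le_pow_right₀ (by norm_num) (by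
        have : S.card ≤ L := by simpa using Finset.card_le_univ S
        omega)
    norm_num at this
    exact this
  have h' := (abs_le.1 h).2
  push_cast at h'
  linarith


/-! ### Counting contexts: the class-`r`-compatible contexts of a pair are at least a sixth -/

/-- The weight of the starting configuration: off-block weight of the context plus the two block
weights of the patterns. -/
theorem wt_start2 (blk : Fin L → Fin k) (a b : Mv L k) (hab : a.1 ≠ b.1) (w : Fin L → Bool) :
    wt (start2 blk a b w) =
      wtOn (univ.filter fun l => blk l ≠ a.1 ∧ blk l ≠ b.1) w + wtOn (blockOf blk a.1) a.2.1 +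
        wtOn (blockOf blk b.1) b.2.1 := by
  unfold start2
  have h1 := wt_bmove blk (bmove blk w a.1 a.2.1) b.1 b.2.1
  have h2 := wt_bmove blk w a.1 a.2.1
  rw [wtOn_blockOf_bmove_ne blk w hab] at h1
  have h3 : wt w = wtOn (blockOf blk a.1) w + wtOn (univ.filter fun l => blk l ≠ a.1) w :=
    wt_eq_wtOn_add blk a.1 w
  have h4 : wtOn (univ.filter fun l => blk l ≠ a.1) w =
      wtOn (blockOf blk b.1) w + wtOn (univ.filter fun l => blk l ≠ a.1 ∧ blk l ≠ b.1) w := by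
    unfold wtOn blockOf
    rw [Finset.filter_filter, Finset.filter_filter, Finset.filter_filter]
    have h := Finset.card_filter_add_card_filter_not
      (s := univ.filter fun l : Fin L => blk l ≠ a.1 ∧ w l = true) (p := fun l => blk l = b.1)
    rw [Finset.filter_filter, Finset.filter_filter] at h
    rw [← h]
    congr 1
    · congr 1; ext l; simp only [Finset.mem_filter, Finset.mem_univ, true_and]
      constructor
      · rintro ⟨⟨_, h2⟩, h3⟩; exact ⟨h3, h2⟩
      · rintro ⟨h3, h2⟩; exact ⟨⟨by rw [h3]; exact hab.symm, h2⟩, h3⟩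
    · congr 1; ext l; simp only [Finset.mem_filter, Finset.mem_univ, true_and]; tauto
  omega

/-- With at least three blocks of size `≥ 2`, the coordinates outside two blocks number `≥ 2`. -/
theorem two_le_card_outside (blk : Fin L → Fin k) (hk : 3 ≤ k)
    (hblk : ∀ i : Fin k, 2 ≤ (univ.filter fun j : Fin L => blk j = i).card) (i j : Fin k) :
    2 ≤ (univ.filter fun l : Fin L => blk l ≠ i ∧ blk l ≠ j).card := by
  -- a third block
  have : ∃ l₀ : Fin k, l₀ ≠ i ∧ l₀ ≠ j := by
    by_contra h
    push Not at h
    have hsub : (univ : Finset (Fin k)) ⊆ {i, j} := fun l _ => by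
      rcases eq_or_ne l i with h1 | h1
      · simp [h1]
      · simp [h l h1]
    have := Finset.card_le_card hsub
    rw [Finset.card_univ, Fintype.card_fin] at this
    have := Finset.card_insert_le i ({j} : Finset (Fin k))
    rw [Finset.card_singleton] at this
    omega
  obtain ⟨l₀, h1, h2⟩ := this
  refine le_trans (hblk l₀) (Finset.card_le_card fun l hl => ?_)
  rw [Finset.mem_filter] at hl ⊢
  exact ⟨hl.1, by rw [hl.2]; exact h1, by rw [hl.2]; exact h2⟩

/-- **Class-compatible contexts are at least a sixth of all contexts.** -/
theorem two_pow_le_six_mul_card_contexts (blk : Fin L → Fin k) (hk : 3 ≤ k)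
    (hblk : ∀ i : Fin k, 2 ≤ (univ.filter fun j : Fin L => blk j = i).card)
    (a b : Mv L k) (hab : a.1 ≠ b.1) (r : ℕ) :
    (2 : ℝ) ^ L ≤ 6 * ((univ.filter fun w : Fin L → Bool => start2 blk a b w ∈ cls L r).card : ℝ) := by
  set S := univ.filter fun l : Fin L => blk l ≠ a.1 ∧ blk l ≠ b.1 with hS
  set s := r + 2 * (wtOn (blockOf blk a.1) a.2.1 + wtOn (blockOf blk b.1) b.2.1) with hs
  have hS2 : 2 ≤ S.card := two_le_card_outside blk hk hblk a.1 b.1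
  have h := card_filter_wtOn_mod_ge S hS2 s
  have heq : (univ.filter fun w : Fin L → Bool => wtOn S w % 3 = s % 3) =
      univ.filter fun w : Fin L → Bool => start2 blk a b w ∈ cls L r := by
    refine Finset.filter_congr fun w _ => ?_
    unfold cls
    rw [Finset.mem_filter, wt_start2 blk a b hab w, ← hS]
    simp only [Finset.mem_univ, true_and, hs]
    omega
  rw [heq] at h
  exact h

/-! ### Counting configurations: the context involution -/

/-- The context involution of a pair of distinct blocks: `(x, x₂, w) ↦ (x|w on i, x₂|w on j, start)`. -/
def ctxInv (blk : Fin L → Fin k) (i j : Fin k) :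
    (Fin L → Bool) × (Fin L → Bool) × (Fin L → Bool) → (Fin L → Bool) × (Fin L → Bool) × (Fin L → Bool) :=
  fun q => (bmove blk q.1 i q.2.2, bmove blk q.2.1 j q.2.2, bmove blk (bmove blk q.2.2 i q.1) j q.2.1)

/-- The context map is an involution (for distinct blocks). -/
theorem ctxInv_involutive (blk : Fin L → Fin k) {i j : Fin k} (hij : i ≠ j) :
    Function.Involutive (ctxInv blk i j) := by
  intro q
  obtain ⟨x, x₂, w⟩ := q
  simp only [ctxInv, Prod.mk.injEq]
  refine ⟨?_, ?_, ?_⟩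
  · funext l
    by_cases h1 : blk l = i
    · have h1' : blk l ≠ j := by rw [h1]; exact hij
      simp [bmove, h1, hij]
    · simp [bmove, h1]
  · funext l
    by_cases h1 : blk l = j
    · simp [bmove, h1]
    · simp [bmove, h1]
  · funext l
    by_cases h1 : blk l = j
    · simp [bmove, h1]
    · by_cases h2 : blk l = i
      · simp [bmove, h2, hij]
      · simp [bmove, h1, h2]

/-- **Every configuration is the start of the same number of (pattern, pattern, context) triples**:
`Σ_{x,x₂,w} [start ∈ T] = 4^L·#T`. -/
theorem sum_indicator_start2 (blk : Fin L → Fin k) {i j : Fin k} (hij : i ≠ j)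
    (T : Finset (Fin L → Bool)) :
    ∑ q : (Fin L → Bool) × (Fin L → Bool) × (Fin L → Bool),
        (if bmove blk (bmove blk q.2.2 i q.1) j q.2.1 ∈ T then (1 : ℝ) else 0) =
      (2 : ℝ) ^ L * (2 : ℝ) ^ L * (T.card : ℝ) := by
  have hinv := ctxInv_involutive blk hij
  let σ : Equiv.Perm ((Fin L → Bool) × (Fin L → Bool) × (Fin L → Bool)) := hinv.toPerm _
  have h1 : ∑ q : (Fin L → Bool) × (Fin L → Bool) × (Fin L → Bool),
      (if bmove blk (bmove blk q.2.2 i q.1) j q.2.1 ∈ T then (1 : ℝ) else 0) =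
      ∑ q : (Fin L → Bool) × (Fin L → Bool) × (Fin L → Bool), (if (σ q).2.2 ∈ T then (1 : ℝ) else 0) := by
    refine Finset.sum_congr rfl fun q _ => ?_
    rfl
  rw [h1, Equiv.sum_comp σ (fun q : (Fin L → Bool) × (Fin L → Bool) × (Fin L → Bool) =>
    if q.2.2 ∈ T then (1 : ℝ) else 0)]
  simp only [Fintype.sum_prod_type]
  have hin : (∑ y₂ : Fin L → Bool, if y₂ ∈ T then (1 : ℝ) else 0) = (T.card : ℝ) := by
    rw [Finset.sum_boole, Finset.filter_univ_mem]
  simp only [hin, Finset.sum_const, Finset.card_univ, Fintype.card_fun, Fintype.card_bool,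
    Fintype.card_fin]
  ring



end BlockAdditive

end Summit.QuantumAdvantage.AdviceFreeQNC0

end
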